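import Summits.Ventures.PercRepro.RankLevelSetFourCircuitNullityThree
import Summits.Ventures.PercRepro.RankLevelSetCountBounds
import Summits.Ventures.PercRepro.S1CoreCapAvg

/-!
# PercRepro — THE SHARP NULLITY-3 TOTAL CAP `s₄ ≤ 7` ON EVERY `e`-FREE CORE (p8 g8, S3)

`proofs/P8-S3-NULLITY3-SHARP.md`; the tree held `8` (RankLevelSetFourCircuitNullityThree, L3), the census maximum is `7`.
Suppose `s₄ = 8`. A nullity-`2` core has `s₄ ∈ {0, 1, 2, 3, 5}` (`ncard_fourCircuits_eq_five_of_four_le`: with `≥ 4` quads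
the `U₃,₅` of L1 holds every quad, hence exactly `5`), and `s₄ = #q(y) + s₄(M ∖ y)` exactly
(`ncard_fourCircuits_eq_through_add_delete`), so with `#q(y) ≤ Q*(3) = 5` every non-coloop `y` has `#q(y) ∈ {3, 5}`.
CLAIM: no non-coloop `y` has `#q(y) = 3`. Otherwise `P := P_y` (the `U₃,₅` of `M ∖ y`, closed by L2) holds the five quads
avoiding `y` and every other quad contains `y`; (a) every `y₂ ∈ P` has `#q(y₂) = 5` (`#q(y₂) = 3` would give a `P_{y₂} ⊇
P ∖ y₂` whose fifth point lies in `cl(P ∖ y₂) = P` — the L3 argument, `not_five_of_mem_five`), so exactly one `y`-quad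
passes through each point of `P` (the four quads of `P` through `y₂` already give `4`); (b) every non-coloop `c ∉ P ∪ {y}`
has `s₄(M ∖ c) ≥ 5` (the quads of `P` avoid `c`), hence `P_c = P` and EVERY `y`-quad contains `c`; so the three `y`-quads
share their part outside `P ∪ {y}`, `|Q_i ∩ P|` is the same for all three, and the `Q_i ∩ P` partition `P`: `5 = 3k`,
impossible. Hence every non-coloop lies on exactly `5` quads and the double count `4·8 = Σ_y #q(y) = 5·m` is impossible:
**`s₄ ≤ 7` on every `e`-free core of nullity `3`** (`ncard_fourCircuits_le_seven_of_nullity_three`). Axioms: standard.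
-/

open scoped Matroid

namespace PercRepro

namespace ThmN

open Set

variable {α : Type}

/-- **The exact split**: the quads of `M` are the quads through `y` together with the quads of `M ∖ y`
(p1's `S1.ncard_fourCircuits_le_through_add_delete` as an equality). -/
theorem ncard_fourCircuits_eq_through_add_delete (M : Matroid α) [M.Finite] (y : α) :
    {C : Set α | M.IsCircuit C ∧ C.ncard = 4}.ncard =
      {C : Set α | M.IsCircuit C ∧ C.ncard = 4 ∧ y ∈ C}.ncard +
        {C : Set α | (M ＼ {y}).IsCircuit C ∧ C.ncard = 4}.ncard := by
  classical
  set S₁ := {C : Set α | M.IsCircuit C ∧ C.ncard = 4 ∧ y ∈ C} with hS₁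
  set S₂ := {C : Set α | (M ＼ {y}).IsCircuit C ∧ C.ncard = 4} with hS₂
  have hS₁fin : S₁.Finite := M.ground_finite.finite_subsets.subset (fun C hC => hC.1.subset_ground)
  have hS₂fin : S₂.Finite :=
    (M ＼ {y}).ground_finite.finite_subsets.subset (fun C hC => hC.1.subset_ground)
  have heq : {C : Set α | M.IsCircuit C ∧ C.ncard = 4} = S₁ ∪ S₂ := by
    ext C
    simp only [hS₁, hS₂, mem_setOf_eq, mem_union, _root_.Matroid.delete_isCircuit_iff,
      disjoint_singleton_right]
    constructor
    · rintro ⟨hC, h4⟩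
      by_cases h : y ∈ C
      · exact Or.inl ⟨hC, h4, h⟩
      · exact Or.inr ⟨⟨hC, h⟩, h4⟩
    · rintro (⟨hC, h4, _⟩ | ⟨⟨hC, _⟩, h4⟩) <;> exact ⟨hC, h4⟩
  have hdisj : Disjoint S₁ S₂ := by
    rw [Set.disjoint_left]
    rintro C ⟨_, _, hyC⟩ ⟨hC', _⟩
    exact (disjoint_singleton_right.1 (_root_.Matroid.delete_isCircuit_iff.1 hC').2) hyC
  rw [heq, Set.ncard_union_eq hdisj hS₁fin hS₂fin]

/-- **Exactly five**: a nullity-`2` core with `s₄ ≥ 4` has `s₄ = 5` — L1's `U₃,₅` holds every quad, and a `5`-set has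
`C(5, 4) = 5` four-subsets. -/
theorem ncard_fourCircuits_eq_five_of_four_le (M : Matroid α) [M.Finite]
    (hfree : ∀ e ∈ M.E, ∃ A ⊆ M.E \ {e}, e ∉ M.closure A ∧ e ∉ M.closure ((M.E \ {e}) \ A))
    (hd : M.E.encard = M.eRank + 2) (h4 : 4 ≤ {C : Set α | M.IsCircuit C ∧ C.ncard = 4}.ncard) :
    {C : Set α | M.IsCircuit C ∧ C.ncard = 4}.ncard = 5 := by
  classical
  obtain ⟨P, hPE, hP5, hPq, hPall⟩ := exists_five_of_four_le_ncard_fourCircuits M hfree hd h4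
  have hfP : P.Finite := M.ground_finite.subset hPE
  have heq : {C : Set α | M.IsCircuit C ∧ C.ncard = 4} =
      {S : Set α | S ⊆ (hfP.toFinset : Set α) ∧ S.ncard = 4} := by
    ext C
    simp only [mem_setOf_eq, Set.Finite.coe_toFinset]
    exact ⟨fun h => ⟨hPall C h.1 h.2, h.2⟩, fun h => ⟨hPq C h.1 h.2, h.2⟩⟩
  rw [heq, ncard_subsets_ncard_eq, ← Set.ncard_eq_toFinset_card P hfP, hP5]
  decide

/-- The `U₃,₅` of a non-coloop `y` with `s₄(M ∖ y) ≥ 4` on a nullity-`3` core, with the exact count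
`s₄(M ∖ y) = 5` (L3's `step` together with `ncard_fourCircuits_eq_five_of_four_le`). -/
theorem exists_five_of_nonColoop_of_four_le (M : Matroid α) [M.Finite]
    (hfree : ∀ e ∈ M.E, ∃ A ⊆ M.E \ {e}, e ∉ M.closure A ∧ e ∉ M.closure ((M.E \ {e}) \ A))
    (hd : M.E.encard = M.eRank + 3) {y : α} (hy : y ∈ M.E) (hyc : ¬ M.IsColoop y)
    (h4 : 4 ≤ {C : Set α | (M ＼ {y}).IsCircuit C ∧ C.ncard = 4}.ncard) :
    ∃ P ⊆ M.E \ {y}, P.ncard = 5 ∧ (∀ S ⊆ P, S.ncard = 4 → M.IsCircuit S) ∧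
      (∀ C, M.IsCircuit C → C.ncard = 4 → y ∉ C → C ⊆ P) ∧
      {C : Set α | (M ＼ {y}).IsCircuit C ∧ C.ncard = 4}.ncard = 5 := by
  have hd' : M.E.encard = M.eRank + ((2 : ℕ) + 1) := by rw [hd]; norm_num
  have hfree' := S1.hfree_delete M hfree y
  have hd2 : (M ＼ {y}).E.encard = (M ＼ {y}).eRank + 2 := delete_nullity_of_nonColoop M hd' hy hyc
  obtain ⟨P, hPE, hP5, hPq, hPall⟩ := exists_five_of_four_le_ncard_fourCircuits (M ＼ {y}) hfree' hd2 h4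
  refine ⟨P, by rwa [_root_.Matroid.delete_ground] at hPE, hP5, fun S hS hS4 => (hPq S hS hS4).of_delete,
    fun C hC hC4 hyC => hPall C (_root_.Matroid.delete_isCircuit_iff.2 ⟨hC, disjoint_singleton_right.2 hyC⟩) hC4,
    ncard_fourCircuits_eq_five_of_four_le (M ＼ {y}) hfree' hd2 h4⟩

/-- **The L3 argument as a lemma**: a `U₃,₅` `P` (closed, L2), a point `y₂ ∈ P`, and a `U₃,₅` `P₂` avoiding `y₂` that
holds every quad avoiding `y₂` cannot coexist — `P₂ ⊇ P ∖ {y₂}` and its fifth point lies in `cl(P ∖ {y₂}) = P`. -/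
theorem not_five_of_mem_five (M : Matroid α) [M.Finite]
    (hfree : ∀ e ∈ M.E, ∃ A ⊆ M.E \ {e}, e ∉ M.closure A ∧ e ∉ M.closure ((M.E \ {e}) \ A))
    {P : Set α} (hPE : P ⊆ M.E) (hP5 : P.ncard = 5) (hPq : ∀ S ⊆ P, S.ncard = 4 → M.IsCircuit S)
    {y₂ : α} (hy₂ : y₂ ∈ P) {P₂ : Set α} (hP₂E : P₂ ⊆ M.E \ {y₂}) (hP₂5 : P₂.ncard = 5)
    (hP₂q : ∀ S ⊆ P₂, S.ncard = 4 → M.IsCircuit S)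
    (hP₂all : ∀ C, M.IsCircuit C → C.ncard = 4 → y₂ ∉ C → C ⊆ P₂) : False := by
  have hfP : P.Finite := M.ground_finite.subset hPE
  have hfP₂ : P₂.Finite := M.ground_finite.subset (hP₂E.trans sdiff_subset)
  -- the quad `T = P ∖ {y₂}` avoids `y₂`, so it lies in `P₂`
  have hT4 : (P \ {y₂}).ncard = 4 := by rw [Set.ncard_sdiff_singleton_of_mem hy₂, hP5]
  have hT : M.IsCircuit (P \ {y₂}) := hPq _ sdiff_subset hT4
  have hTP₂ : P \ {y₂} ⊆ P₂ := hP₂all _ hT hT4 (fun h => h.2 (mem_singleton y₂))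
  -- the fifth point `z` of `P₂`
  obtain ⟨z, hzP₂, hzT⟩ : (P₂ \ (P \ {y₂})).Nonempty := by
    rw [← Set.ncard_pos (hfP₂.sdiff), Set.ncard_sdiff hTP₂ (hfP.sdiff), hP₂5, hT4]; norm_num
  have hzy₂ : z ≠ y₂ := fun h => (hP₂E hzP₂).2 (h ▸ mem_singleton y₂)
  have hzP : z ∉ P := fun h => hzT ⟨h, fun h' => hzy₂ (mem_singleton_iff.1 h')⟩
  -- `z ∈ cl(P ∖ {y₂})` by the quad `insert z ((P ∖ {y₂}) ∖ {t})` of `P₂`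
  obtain ⟨t, ht⟩ : (P \ {y₂}).Nonempty := by rw [← Set.ncard_pos (hfP.sdiff), hT4]; norm_num
  have hq' : M.IsCircuit (insert z ((P \ {y₂}) \ {t})) :=
    hP₂q _ (insert_subset hzP₂ (sdiff_subset.trans hTP₂)) (by
      rw [Set.ncard_insert_of_notMem (fun h => hzT h.1) ((hfP.sdiff).sdiff),
        Set.ncard_sdiff_singleton_of_mem ht, hT4])
  have hzcl : z ∈ M.closure (P \ {y₂}) := by
    have hmem := hq'.mem_closure_sdiff_singleton_of_mem (mem_insert z _)
    refine M.closure_subset_closure ?_ hmem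
    intro x hx
    obtain ⟨hx1, hx2⟩ := hx
    rcases hx1 with hx1 | hx1
    · exact absurd (mem_singleton_iff.2 hx1) hx2
    · exact hx1.1
  have hcl : M.closure P = P := closure_eq_self_of_five M hfree hPE hP5 hPq
  have hz : z ∈ M.closure P := M.closure_subset_closure sdiff_subset hzcl
  rw [hcl] at hz
  exact hzP hz

/-- **THE SHARP NULLITY-3 CAP — `s₄ ≤ 7` on every `e`-free core of nullity `3`** (the census maximum; the tree's `8`).
With `s₄ = 8` every non-coloop `y` has `#q(y) ∈ {3, 5}`; a non-coloop `y` with `#q(y) = 3` is impossible (its `U₃,₅` `P`: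
one `y`-quad through each point of `P`, every outside non-coloop on every `y`-quad, so the three `y`-quads meet `P` in
three disjoint parts of one size `k`, `5 = 3k`); so every non-coloop lies on exactly `5` quads and `4·8 = 5·m`. -/
theorem ncard_fourCircuits_le_seven_of_nullity_three (M : Matroid α) [M.Finite]
    (hfree : ∀ e ∈ M.E, ∃ A ⊆ M.E \ {e}, e ∉ M.closure A ∧ e ∉ M.closure ((M.E \ {e}) \ A))
    (hd : M.E.encard = M.eRank + 3) : {C : Set α | M.IsCircuit C ∧ C.ncard = 4}.ncard ≤ 7 := by
  classical
  have h8 := ncard_fourCircuits_le_eight_of_nullity_three M hfree hd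
  by_contra hlt
  have hs : {C : Set α | M.IsCircuit C ∧ C.ncard = 4}.ncard = 8 := by omega
  have hqcap : ∀ y ∈ M.E, {C : Set α | M.IsCircuit C ∧ C.ncard = 4 ∧ y ∈ C}.ncard ≤ 5 := by
    intro y hy
    have hq := S1.ncard_fourCircuitsThrough_le_qKer 3 M hfree (by exact_mod_cast hd) y hy
    have hq5 : S1.qKer 3 = 5 := by decide
    omega
  have hsplit : ∀ y, {C : Set α | M.IsCircuit C ∧ C.ncard = 4 ∧ y ∈ C}.ncard +
      {C : Set α | (M ＼ {y}).IsCircuit C ∧ C.ncard = 4}.ncard = 8 := by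
    intro y
    rw [← hs]
    exact (ncard_fourCircuits_eq_through_add_delete M y).symm
  -- CLAIM: every non-coloop lies on exactly `5` quads
  have claim : ∀ y ∈ M.E, ¬ M.IsColoop y →
      {C : Set α | M.IsCircuit C ∧ C.ncard = 4 ∧ y ∈ C}.ncard = 5 := by
    intro y hy hyc
    by_contra hne
    have h4 : 4 ≤ {C : Set α | (M ＼ {y}).IsCircuit C ∧ C.ncard = 4}.ncard := by
      have := hsplit y; have := hqcap y hy; omega
    obtain ⟨P, hPE, hP5, hPq, hPall, hs'⟩ := exists_five_of_nonColoop_of_four_le M hfree hd hy hyc h4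
    have hqy : {C : Set α | M.IsCircuit C ∧ C.ncard = 4 ∧ y ∈ C}.ncard = 3 := by have := hsplit y; omega
    have hPE' : P ⊆ M.E := hPE.trans sdiff_subset
    have hfP : P.Finite := M.ground_finite.subset hPE'
    have hyP : y ∉ P := fun h => (hPE h).2 (mem_singleton y)
    -- the four-subsets of `P` number `5`
    have hA5 : {S : Set α | S ⊆ P ∧ S.ncard = 4}.ncard = 5 := by
      have heq : {S : Set α | S ⊆ P ∧ S.ncard = 4} = {S : Set α | S ⊆ (hfP.toFinset : Set α) ∧ S.ncard = 4} := by
        ext S; simp only [mem_setOf_eq, Set.Finite.coe_toFinset]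
      rw [heq, ncard_subsets_ncard_eq, ← Set.ncard_eq_toFinset_card P hfP, hP5]
      decide
    have hAfin : {S : Set α | S ⊆ P ∧ S.ncard = 4}.Finite :=
      hfP.finite_subsets.subset (fun S hS => hS.1)
    -- every point of `P` is a non-coloop (it lies on a quad of `P`)
    have hPnc : ∀ y₂ ∈ P, ¬ M.IsColoop y₂ := by
      intro y₂ hy₂
      obtain ⟨w, hw, hwy⟩ := Set.exists_ne_of_one_lt_ncard (show 1 < P.ncard by omega) y₂
      have hCw : M.IsCircuit (P \ {w}) := hPq _ sdiff_subset (by rw [Set.ncard_sdiff_singleton_of_mem hw, hP5])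
      exact hCw.not_isColoop_of_mem ⟨hy₂, fun h => hwy (mem_singleton_iff.1 h).symm⟩
    -- (a) every point of `P` lies on exactly `5` quads
    have hPq5 : ∀ y₂ ∈ P, {C : Set α | M.IsCircuit C ∧ C.ncard = 4 ∧ y₂ ∈ C}.ncard = 5 := by
      intro y₂ hy₂
      by_contra hne₂
      have h4₂ : 4 ≤ {C : Set α | (M ＼ {y₂}).IsCircuit C ∧ C.ncard = 4}.ncard := by
        have := hsplit y₂; have := hqcap y₂ (hPE' hy₂); omega
      obtain ⟨P₂, hP₂E, hP₂5, hP₂q, hP₂all, -⟩ :=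
        exists_five_of_nonColoop_of_four_le M hfree hd (hPE' hy₂) (hPnc y₂ hy₂) h4₂
      exact not_five_of_mem_five M hfree hPE' hP5 hPq hy₂ hP₂E hP₂5 hP₂q hP₂all
    -- (b) every non-coloop outside `P ∪ {y}` lies on every `y`-quad
    have hout : ∀ c ∈ M.E, ¬ M.IsColoop c → c ∉ P → c ≠ y →
        ∀ C, M.IsCircuit C → C.ncard = 4 → y ∈ C → c ∈ C := by
      intro c hc hcc hcP hcy C hC hC4 hyC
      by_contra hcC
      -- the quads of `P` avoid `c`: `s₄(M ∖ c) ≥ 5`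
      have h5 : 5 ≤ {C : Set α | (M ＼ {c}).IsCircuit C ∧ C.ncard = 4}.ncard := by
        have hsub : {S : Set α | S ⊆ P ∧ S.ncard = 4} ⊆ {C : Set α | (M ＼ {c}).IsCircuit C ∧ C.ncard = 4} := by
          intro S hS
          exact ⟨_root_.Matroid.delete_isCircuit_iff.2 ⟨hPq S hS.1 hS.2,
            disjoint_singleton_right.2 (fun h => hcP (hS.1 h))⟩, hS.2⟩
        have := Set.ncard_le_ncard hsub
          ((M ＼ {c}).ground_finite.finite_subsets.subset (fun C hC => hC.1.subset_ground))
        omega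
      obtain ⟨Pc, hPcE, hPc5, hPcq, hPcall, -⟩ :=
        exists_five_of_nonColoop_of_four_le M hfree hd hc hcc (by omega)
      -- `P ⊆ Pc`: each point of `P` lies on a quad of `P`, which avoids `c`
      have hPPc : P ⊆ Pc := by
        intro p hp
        obtain ⟨w, hw, hwp⟩ := Set.exists_ne_of_one_lt_ncard (show 1 < P.ncard by omega) p
        have hS4 : (P \ {w}).ncard = 4 := by rw [Set.ncard_sdiff_singleton_of_mem hw, hP5]
        have hsub := hPcall _ (hPq _ sdiff_subset hS4) hS4 (fun h => hcP h.1)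
        exact hsub ⟨hp, fun h => hwp (mem_singleton_iff.1 h).symm⟩
      have hPeq : P = Pc := Set.eq_of_subset_of_ncard_le hPPc (by rw [hP5, hPc5])
        (M.ground_finite.subset (hPcE.trans sdiff_subset))
      have hCP := hPcall C hC hC4 hcC
      rw [← hPeq] at hCP
      exact hyP (hCP hyC)
    -- the `y`-quads `Q₁, Q₂, Q₃`
    obtain ⟨Q₁, Q₂, Q₃, h12, h13, h23, hQ⟩ := Set.ncard_eq_three.1 hqy
    have hQmem : ∀ Q ∈ ({Q₁, Q₂, Q₃} : Set (Set α)), M.IsCircuit Q ∧ Q.ncard = 4 ∧ y ∈ Q := by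
      intro Q hQ'; rw [← hQ] at hQ'; exact hQ'
    -- (d) through each point of `P` passes at least one and at most one `y`-quad
    have hinside : ∀ y₂ ∈ P, {S : Set α | S ⊆ P ∧ S.ncard = 4 ∧ y₂ ∈ S}.ncard = 4 := by
      intro y₂ hy₂
      have hsplitA : {S : Set α | S ⊆ P ∧ S.ncard = 4} =
          insert (P \ {y₂}) {S : Set α | S ⊆ P ∧ S.ncard = 4 ∧ y₂ ∈ S} := by
        ext S
        simp only [mem_setOf_eq, mem_insert_iff]
        constructor
        · rintro ⟨hSP, hS4⟩
          by_cases h : y₂ ∈ S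
          · exact Or.inr ⟨hSP, hS4, h⟩
          · left
            have hsub : S ⊆ P \ {y₂} := fun x hx => ⟨hSP hx, fun h' => h (mem_singleton_iff.1 h' ▸ hx)⟩
            exact Set.eq_of_subset_of_ncard_le hsub
              (by rw [hS4, Set.ncard_sdiff_singleton_of_mem hy₂, hP5]) (hfP.sdiff)
        · rintro (rfl | ⟨hSP, hS4, _⟩)
          · exact ⟨sdiff_subset, by rw [Set.ncard_sdiff_singleton_of_mem hy₂, hP5]⟩
          · exact ⟨hSP, hS4⟩
      have hnot : P \ {y₂} ∉ {S : Set α | S ⊆ P ∧ S.ncard = 4 ∧ y₂ ∈ S} := fun h => h.2.2.2 (mem_singleton y₂)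
      have hfin : {S : Set α | S ⊆ P ∧ S.ncard = 4 ∧ y₂ ∈ S}.Finite := hAfin.subset (fun S hS => ⟨hS.1, hS.2.1⟩)
      rw [hsplitA, Set.ncard_insert_of_notMem hnot hfin] at hA5
      omega
    have hinsideQ : ∀ y₂ ∈ P, {S : Set α | S ⊆ P ∧ S.ncard = 4 ∧ y₂ ∈ S} ⊆
        {C : Set α | M.IsCircuit C ∧ C.ncard = 4 ∧ y₂ ∈ C} :=
      fun y₂ _ S hS => ⟨hPq S hS.1 hS.2.1, hS.2.1, hS.2.2⟩
    have hqfin : ∀ y₂, {C : Set α | M.IsCircuit C ∧ C.ncard = 4 ∧ y₂ ∈ C}.Finite :=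
      fun y₂ => M.ground_finite.finite_subsets.subset (fun C hC => hC.1.subset_ground)
    have hatleast : ∀ y₂ ∈ P, ∃ Q ∈ ({Q₁, Q₂, Q₃} : Set (Set α)), y₂ ∈ Q := by
      intro y₂ hy₂
      by_contra hno
      push Not at hno
      have hsub : {C : Set α | M.IsCircuit C ∧ C.ncard = 4 ∧ y₂ ∈ C} ⊆
          {S : Set α | S ⊆ P ∧ S.ncard = 4 ∧ y₂ ∈ S} := by
        rintro C ⟨hC, hC4, hy₂C⟩
        have hyC : y ∉ C := fun hyC => hno C (by rw [← hQ]; exact ⟨hC, hC4, hyC⟩) hy₂C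
        exact ⟨hPall C hC hC4 hyC, hC4, hy₂C⟩
      have := Set.ncard_le_ncard hsub (hAfin.subset (fun S hS => ⟨hS.1, hS.2.1⟩))
      rw [hPq5 y₂ hy₂, hinside y₂ hy₂] at this
      omega
    have hatmost : ∀ y₂ ∈ P, ∀ Q ∈ ({Q₁, Q₂, Q₃} : Set (Set α)), ∀ Q' ∈ ({Q₁, Q₂, Q₃} : Set (Set α)),
        Q ≠ Q' → y₂ ∈ Q → y₂ ∈ Q' → False := by
      intro y₂ hy₂ Q hQ' Q' hQ'' hne hy₂Q hy₂Q'
      obtain ⟨hQc, hQ4, hyQ⟩ := hQmem Q hQ'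
      obtain ⟨hQ'c, hQ'4, hyQ'⟩ := hQmem Q' hQ''
      have hQnot : Q ∉ {S : Set α | S ⊆ P ∧ S.ncard = 4 ∧ y₂ ∈ S} := fun h => hyP (h.1 hyQ)
      have hQ'not : Q' ∉ insert Q {S : Set α | S ⊆ P ∧ S.ncard = 4 ∧ y₂ ∈ S} := by
        rintro (h | h)
        · exact hne h.symm
        · exact hyP (h.1 hyQ')
      have hfin : {S : Set α | S ⊆ P ∧ S.ncard = 4 ∧ y₂ ∈ S}.Finite := hAfin.subset (fun S hS => ⟨hS.1, hS.2.1⟩)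
      have hsub : insert Q' (insert Q {S : Set α | S ⊆ P ∧ S.ncard = 4 ∧ y₂ ∈ S}) ⊆
          {C : Set α | M.IsCircuit C ∧ C.ncard = 4 ∧ y₂ ∈ C} := by
        rintro C (rfl | rfl | hC)
        · exact ⟨hQ'c, hQ'4, hy₂Q'⟩
        · exact ⟨hQc, hQ4, hy₂Q⟩
        · exact hinsideQ y₂ hy₂ hC
      have := Set.ncard_le_ncard hsub (hqfin y₂)
      rw [Set.ncard_insert_of_notMem hQ'not (hfin.insert Q), Set.ncard_insert_of_notMem hQnot hfin,
        hinside y₂ hy₂, hPq5 y₂ hy₂] at this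
      omega
    -- (e) the three `y`-quads meet `P` in parts of one size `k`, and these partition `P`: `5 = 3k`
    have hQP : ∀ Q ∈ ({Q₁, Q₂, Q₃} : Set (Set α)), ∀ Q' ∈ ({Q₁, Q₂, Q₃} : Set (Set α)),
        (Q ∩ P).ncard = (Q' ∩ P).ncard := by
      -- the parts outside `P ∪ {y}` agree
      have houtside : ∀ Q ∈ ({Q₁, Q₂, Q₃} : Set (Set α)), ∀ Q' ∈ ({Q₁, Q₂, Q₃} : Set (Set α)),
          Q \ insert y P ⊆ Q' \ insert y P := by
        intro Q hQ' Q' hQ'' c hc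
        obtain ⟨hQc, hQ4, _⟩ := hQmem Q hQ'
        obtain ⟨hQ'c, hQ'4, hyQ'⟩ := hQmem Q' hQ''
        have hcy : c ≠ y := fun h => hc.2 (h ▸ mem_insert y P)
        have hcP : c ∉ P := fun h => hc.2 (mem_insert_of_mem y h)
        exact ⟨hout c (hQc.subset_ground hc.1) (hQc.not_isColoop_of_mem hc.1) hcP hcy Q' hQ'c hQ'4 hyQ', hc.2⟩
      -- `|Q ∩ P| + 1 + |Q ∖ (P ∪ {y})| = 4`
      have hcount : ∀ Q ∈ ({Q₁, Q₂, Q₃} : Set (Set α)), (Q ∩ P).ncard + 1 + (Q \ insert y P).ncard = 4 := by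
        intro Q hQ'
        obtain ⟨hQc, hQ4, hyQ⟩ := hQmem Q hQ'
        have hfQ : Q.Finite := M.ground_finite.subset hQc.subset_ground
        have h1 := Set.ncard_inter_add_ncard_sdiff_eq_ncard Q (insert y P) hfQ
        have h2 : Q ∩ insert y P = insert y (Q ∩ P) := by
          ext x
          simp only [mem_inter_iff, mem_insert_iff]
          constructor
          · rintro ⟨hxQ, rfl | hxP⟩
            · exact Or.inl rfl
            · exact Or.inr ⟨hxQ, hxP⟩
          · rintro (rfl | ⟨hxQ, hxP⟩)
            · exact ⟨hyQ, Or.inl rfl⟩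
            · exact ⟨hxQ, Or.inr hxP⟩
        have h3 : y ∉ Q ∩ P := fun h => hyP h.2
        rw [h2, Set.ncard_insert_of_notMem h3 (hfQ.subset inter_subset_left), hQ4] at h1
        omega
      intro Q hQ' Q' hQ''
      have hO : Q \ insert y P = Q' \ insert y P :=
        subset_antisymm (houtside Q hQ' Q' hQ'') (houtside Q' hQ'' Q hQ')
      have := hcount Q hQ'
      have := hcount Q' hQ''
      rw [hO] at *
      omega
    have hcover : P = (Q₁ ∩ P) ∪ (Q₂ ∩ P) ∪ (Q₃ ∩ P) := by
      ext x
      simp only [mem_union, mem_inter_iff]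
      constructor
      · intro hx
        obtain ⟨Q, hQ', hxQ⟩ := hatleast x hx
        rcases hQ' with rfl | rfl | rfl
        · exact Or.inl (Or.inl ⟨hxQ, hx⟩)
        · exact Or.inl (Or.inr ⟨hxQ, hx⟩)
        · exact Or.inr ⟨hxQ, hx⟩
      · rintro ((⟨_, hx⟩ | ⟨_, hx⟩) | ⟨_, hx⟩) <;> exact hx
    have hd12 : Disjoint (Q₁ ∩ P) (Q₂ ∩ P) := by
      rw [Set.disjoint_left]
      rintro x ⟨hx1, hxP⟩ ⟨hx2, _⟩
      exact hatmost x hxP Q₁ (by simp) Q₂ (by simp) h12 hx1 hx2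
    have hd3 : Disjoint ((Q₁ ∩ P) ∪ (Q₂ ∩ P)) (Q₃ ∩ P) := by
      rw [Set.disjoint_left]
      rintro x (⟨hx1, hxP⟩ | ⟨hx2, hxP⟩) ⟨hx3, _⟩
      · exact hatmost x hxP Q₁ (by simp) Q₃ (by simp) h13 hx1 hx3
      · exact hatmost x hxP Q₂ (by simp) Q₃ (by simp) h23 hx2 hx3
    have hf1 : (Q₁ ∩ P).Finite := hfP.subset inter_subset_right
    have hf2 : (Q₂ ∩ P).Finite := hfP.subset inter_subset_right
    have hf3 : (Q₃ ∩ P).Finite := hfP.subset inter_subset_right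
    have hsum : P.ncard = (Q₁ ∩ P).ncard + (Q₂ ∩ P).ncard + (Q₃ ∩ P).ncard := by
      have h := Set.ncard_union_eq hd3 (hf1.union hf2) hf3
      rw [Set.ncard_union_eq hd12 hf1 hf2, ← hcover] at h
      exact h
    have e12 := hQP Q₁ (by simp) Q₂ (by simp)
    have e13 := hQP Q₁ (by simp) Q₃ (by simp)
    omega
  -- the double count: `4 · 8 = Σ_y #q(y) = 5 · m`
  have hsum := S1.sum_ncard_fourCircuitsThrough_eq M
  rw [hs] at hsum
  have hsum' : ∑ x ∈ M.ground_finite.toFinset.filter (fun x => ¬ M.IsColoop x),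
      {C : Set α | M.IsCircuit C ∧ C.ncard = 4 ∧ x ∈ C}.ncard = 4 * 8 := by
    rw [Finset.sum_filter_of_ne]
    · exact hsum
    · intro x _ hfx hcol
      exact hfx (S1.ncard_fourCircuitsThrough_eq_zero_of_isColoop M hcol)
  have hconst : ∑ x ∈ M.ground_finite.toFinset.filter (fun x => ¬ M.IsColoop x),
      {C : Set α | M.IsCircuit C ∧ C.ncard = 4 ∧ x ∈ C}.ncard =
      ∑ x ∈ M.ground_finite.toFinset.filter (fun x => ¬ M.IsColoop x), 5 := by
    refine Finset.sum_congr rfl (fun x hx => ?_)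
    rw [Finset.mem_filter, Set.Finite.mem_toFinset] at hx
    exact claim x hx.1 hx.2
  rw [hconst, Finset.sum_const, smul_eq_mul] at hsum'
  omega

end ThmN

end PercRepro
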